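import Summits.CriticalPhenomena.PercolationContinuityZ3.Theorems.SahiMasterFamilyPointwisePrincipalCapSeven
import Summits.CriticalPhenomena.PercolationContinuityZ3.Theorems.SahiMasterFamilyBernsteinGoodCoordinate
import Summits.CriticalPhenomena.PercolationContinuityZ3.Theorems.SahiMasterFamilyMinorClosed
import Summits.CriticalPhenomena.PercolationContinuityZ3.Theorems.SahiMasterFamilyEqImpliesNonneg
import Summits.CriticalPhenomena.PercolationContinuityZ3.Theorems.PercNearOneGluingNoHeavyLowerTailCovKLInduction

/-!
# The pointwise master conjecture is equivalent to MINOR DOMINATION (every order `k ≤ 7`)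

Unit `prim-master-conj` (crux anchor stmt-CriticalPhenomena-4575, helper work), gen 15; memo
`run/shared/lean/prim/prim-l12/prim-master-conj/POINTWISE.md` §16.

Say that an increasing family `U` DOMINATES ITS MINORS at the coordinate `e` and the parameter `p` if
  `c₀ · E_k(μ_p; U^{e←0}) + c₁ · E_k(μ_p; U^{e←1}) ≤ E_k(μ_p; U)`   for SOME constants `c₀, c₁ > 0`
(allowed to depend on `U, e, p`; `U^{e←b} = (secAt e b (U j))_j` are the two one-coordinate minors).  Examples: every coordinate private
to one member (there `E_k` is affine in `p_e`); every family with a degree-`c` comb certificate (`c₀ = (1−p_e)^{c_e}`, `c₁ = p_e^{c_e}`);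
at order 3, every coordinate whose two mixed Bernstein coefficients `mixC1_e, mixC2_e` are `≥ 0` (`c₀ = (1−p_e)³`, `c₁ = p_e³`,
`minorDomination_of_mixC_nonneg`) — so domination is implied by P3's one-edge orthant condition `H(1,k)`, far below the top corner (M⁺-k).

MAIN THEOREM (`sahiE_ind_nonneg_and_eq_zero_iff_on_class_of_minorDomination`, `k ≤ 7`): on any SECTION-CLOSED class `𝒞` of increasing
`k`-families of a finite cube, minor domination at an interior `p` (for every member of `𝒞` and every coordinate) implies the full pointwise
master statement on `𝒞` at `p`: `E_k(μ_p; 1_U) ≥ 0` and `E_k(μ_p; 1_U) = 0 ↔ U ∈ Z_k`.  Proof: induction on a determining set; domination makes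
a zero of `U` a zero of BOTH minors at EVERY coordinate, so by induction all minors are zero flags, i.e. `U` is face-vanishing — and on the
face-vanishing class the pointwise statement is a theorem for every `k ≤ 7` (gens 13–14, `sahiE_ind_eq_zero_iff_of_faceVanishing_of_le_seven`).
Conversely domination is NECESSARY (`minorDomination_of_masterFamilyEqIff`: a zero flag has zero-flag minors, `suppZeroFlag_secAt_family`),
whence the EQUIVALENT REFORMULATION
  **`masterFamilyEqIff_iff_minorDomination`: for `k ≤ 7`, `MasterFamilyEqIff k` ⟺ every increasing `k`-family dominates its minors at every
  coordinate and every interior parameter** —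
the pointwise equality conjecture (which contains Sahi's `C_k` / Kahn's Conjecture 5 for product measures) is exactly a "no cancellation
between the two minors" inequality schema with free positive constants.  Corollaries: `masterFamilyNonneg_of_minorDomination` (every order
`≥ 2`, closed cube, constants `≥ 0`); `masterFamilyEqIff_three_of_mixC_nonneg` (H(1,3) ⟹ (EQ-3), improving gen 13's (M⁺-3) ⟹ (EQ-3) and
gen 14's H(1,3) ⟹ C₃).
HONEST FRAMING: reductions and an equivalence; `MasterFamilyEqIff k` (k ≥ 3), `C_k` and the domination schema itself remain OPEN.  Axioms standard.
[this work]
-/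

noncomputable section

open scoped Classical

namespace Summit.CriticalPhenomena.PercolationContinuityZ3.Theorems

open Finset Function
open Literature.Combinatorics.Sahi2008
open Literature.Probability.Percolation (DeterminedBy determinedBy_iff)
open Literature.Probability.Percolation.DecisionTree (ind)
open SahiCombMix

namespace Pointwise

variable {ι : Type} [Fintype ι]

/-! ### 1. The class theorem: minor domination on a section-closed class ⟹ `C_k` and the pointwise zero locus there (`k ≤ 7`) -/

/-- **Minor domination on a section-closed class implies the pointwise master statement on the class** (`k ≤ 7`).  Let `𝒞` be a class of
increasing `k`-families closed under one-coordinate sections and `p` an interior parameter such that every `U ∈ 𝒞` dominates its two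
`e`-minors at `p` for every coordinate `e` (constants `c₀, c₁ > 0` free).  Then `E_k(μ_p; 1_U) ≥ 0` and `E_k(μ_p; 1_U) = 0 ↔ U ∈ Z_k` for every
`U ∈ 𝒞`. [this work] -/
theorem sahiE_ind_nonneg_and_eq_zero_iff_on_class_of_minorDomination {k : ℕ} (hk : k ≤ 7) (p : ι → unitInterval)
    (hp : ∀ e, (p e : ℝ) ∈ Set.Ioo (0 : ℝ) 1) (𝒞 : (Fin k → Set (Set ι)) → Prop) (h𝒞 : ∀ U, 𝒞 U → ∀ j, IsUpperSet (U j))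
    (hsec : ∀ U, 𝒞 U → ∀ (e : ι) (b : Bool), 𝒞 (fun j => secAt e b (U j)))
    (hdom : ∀ U, 𝒞 U → ∀ e : ι, ∃ c₀ c₁ : ℝ, 0 < c₀ ∧ 0 < c₁ ∧
      c₀ * sahiE (bernoulliWeight p) k (fun j => ind (secAt e false (U j))) +
        c₁ * sahiE (bernoulliWeight p) k (fun j => ind (secAt e true (U j))) ≤ sahiE (bernoulliWeight p) k (fun j => ind (U j)))
    (U : Fin k → Set (Set ι)) (hU : 𝒞 U) :
    0 ≤ sahiE (bernoulliWeight p) k (fun j => ind (U j)) ∧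
      (sahiE (bernoulliWeight p) k (fun j => ind (U j)) = 0 ↔ SuppZeroFlag k U) := by
  suffices key : ∀ (m : ℕ) (V : Fin k → Set (Set ι)) (S : Finset ι), S.card = m → 𝒞 V →
      (∀ j, DeterminedBy (V j) (↑S : Set ι)) →
        0 ≤ sahiE (bernoulliWeight p) k (fun j => ind (V j)) ∧
          (sahiE (bernoulliWeight p) k (fun j => ind (V j)) = 0 ↔ SuppZeroFlag k V) from
    key _ U Finset.univ rfl hU fun j => CovKL.determinedBy_coe_univ (U j)
  intro m
  induction m using Nat.strong_induction_on with
  | _ m ih =>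
  intro V S hS hV hVS
  -- the two `e`-minors, for `e ∈ S`, are settled by induction
  have hmin : ∀ e ∈ S, ∀ b : Bool,
      0 ≤ sahiE (bernoulliWeight p) k (fun j => ind (secAt e b (V j))) ∧
        (sahiE (bernoulliWeight p) k (fun j => ind (secAt e b (V j))) = 0 ↔ SuppZeroFlag k (fun j => secAt e b (V j))) := by
    intro e heS b
    have hlt : (S.erase e).card < m := by rw [← hS]; exact Finset.card_erase_lt_of_mem heS
    exact ih _ hlt (fun j => secAt e b (V j)) (S.erase e) rfl (hsec V hV e b) fun j => determinedBy_secAt e b (hVS j)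
  -- positivity
  have hpos : 0 ≤ sahiE (bernoulliWeight p) k (fun j => ind (V j)) := by
    rcases S.eq_empty_or_nonempty with hSe | ⟨e, heS⟩
    · subst hSe
      exact sahiE_ind_nonneg_of_faceVanishing_of_le_seven hk p V ∅ (h𝒞 V hV) hVS (fun e he => absurd he (by simp))
    · obtain ⟨c₀, c₁, hc₀, hc₁, hle⟩ := hdom V hV e
      have h0 := (hmin e heS false).1
      have h1 := (hmin e heS true).1
      nlinarith
  refine ⟨hpos, fun h0 => ?_, fun hZ => masterFamilyEqIff_mpr k ι p V hZ⟩
  -- a zero of `V` is a zero of both minors at every coordinate of `S`, hence `V` is face-vanishing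
  have hall : ∀ e ∈ S, ∀ b : Bool, SuppZeroFlag k (fun j => secAt e b (V j)) := by
    intro e heS b
    obtain ⟨c₀, c₁, hc₀, hc₁, hle⟩ := hdom V hV e
    have hA0 := (hmin e heS false).1
    have hA1 := (hmin e heS true).1
    rw [h0] at hle
    have hz0 : sahiE (bernoulliWeight p) k (fun j => ind (secAt e false (V j))) = 0 := by nlinarith
    have hz1 : sahiE (bernoulliWeight p) k (fun j => ind (secAt e true (V j))) = 0 := by nlinarith
    cases b
    · exact (hmin e heS false).2.1 hz0
    · exact (hmin e heS true).2.1 hz1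
  exact (sahiE_ind_eq_zero_iff_of_faceVanishing_of_le_seven hk p hp V S (h𝒞 V hV) hVS hall).1 h0

/-- Strict form on the class: off `Z_k`, `E_k(μ_p; 1_U) > 0`. [this work] -/
theorem sahiE_ind_pos_on_class_of_minorDomination {k : ℕ} (hk : k ≤ 7) (p : ι → unitInterval)
    (hp : ∀ e, (p e : ℝ) ∈ Set.Ioo (0 : ℝ) 1) (𝒞 : (Fin k → Set (Set ι)) → Prop) (h𝒞 : ∀ U, 𝒞 U → ∀ j, IsUpperSet (U j))
    (hsec : ∀ U, 𝒞 U → ∀ (e : ι) (b : Bool), 𝒞 (fun j => secAt e b (U j)))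
    (hdom : ∀ U, 𝒞 U → ∀ e : ι, ∃ c₀ c₁ : ℝ, 0 < c₀ ∧ 0 < c₁ ∧
      c₀ * sahiE (bernoulliWeight p) k (fun j => ind (secAt e false (U j))) +
        c₁ * sahiE (bernoulliWeight p) k (fun j => ind (secAt e true (U j))) ≤ sahiE (bernoulliWeight p) k (fun j => ind (U j)))
    (U : Fin k → Set (Set ι)) (hU : 𝒞 U) (hZ : ¬ SuppZeroFlag k U) :
    0 < sahiE (bernoulliWeight p) k (fun j => ind (U j)) := by
  obtain ⟨h0, hiff⟩ := sahiE_ind_nonneg_and_eq_zero_iff_on_class_of_minorDomination hk p hp 𝒞 h𝒞 hsec hdom U hU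
  exact lt_of_le_of_ne h0 fun h => hZ (hiff.1 h.symm)

/-! ### 2. Positivity alone: every order `n + 2`, closed cube, constants `≥ 0` -/

/-- **Minor domination with nonnegative constants on a section-closed class implies `C_{n+2}` on the class**, at EVERY `p ∈ [0,1]^ι`
(no face-vanishing input: induction on a determining set, the base being the mutually independent families). [this work] -/
theorem sahiE_ind_nonneg_on_class_of_minorDomination {n : ℕ} (p : ι → unitInterval) (𝒞 : (Fin (n + 2) → Set (Set ι)) → Prop)
    (hsec : ∀ U, 𝒞 U → ∀ (e : ι) (b : Bool), 𝒞 (fun j => secAt e b (U j)))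
    (hdom : ∀ U, 𝒞 U → ∀ e : ι, ∃ c₀ c₁ : ℝ, 0 ≤ c₀ ∧ 0 ≤ c₁ ∧
      c₀ * sahiE (bernoulliWeight p) (n + 2) (fun j => ind (secAt e false (U j))) +
        c₁ * sahiE (bernoulliWeight p) (n + 2) (fun j => ind (secAt e true (U j))) ≤
          sahiE (bernoulliWeight p) (n + 2) (fun j => ind (U j)))
    (U : Fin (n + 2) → Set (Set ι)) (hU : 𝒞 U) : 0 ≤ sahiE (bernoulliWeight p) (n + 2) (fun j => ind (U j)) := by
  suffices key : ∀ (m : ℕ) (V : Fin (n + 2) → Set (Set ι)) (S : Finset ι), S.card = m → 𝒞 V →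
      (∀ j, DeterminedBy (V j) (↑S : Set ι)) → 0 ≤ sahiE (bernoulliWeight p) (n + 2) (fun j => ind (V j)) from
    key _ U Finset.univ rfl hU fun j => CovKL.determinedBy_coe_univ (U j)
  intro m
  induction m using Nat.strong_induction_on with
  | _ m ih =>
  intro V S hS hV hVS
  rcases S.eq_empty_or_nonempty with hSe | ⟨e, heS⟩
  · subst hSe
    exact (masterFamilyEqIff_mpr (n + 2) ι p V
      (suppZeroFlag_of_pairwise_disjoint n V (fun _ => ∅) (fun _ _ _ => disjoint_bot_left) hVS)).ge
  · obtain ⟨c₀, c₁, hc₀, hc₁, hle⟩ := hdom V hV e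
    have hlt : (S.erase e).card < m := by rw [← hS]; exact Finset.card_erase_lt_of_mem heS
    have h0 := ih _ hlt (fun j => secAt e false (V j)) (S.erase e) rfl (hsec V hV e false) fun j => determinedBy_secAt e false (hVS j)
    have h1 := ih _ hlt (fun j => secAt e true (V j)) (S.erase e) rfl (hsec V hV e true) fun j => determinedBy_secAt e true (hVS j)
    nlinarith

/-! ### 3. Global forms: the equivalence -/

/-- **Sufficiency**: minor domination everywhere (interior parameters) implies `MasterFamilyEqIff k`, `k ≤ 7`. [this work] -/
theorem masterFamilyEqIff_of_minorDomination {k : ℕ} (hk : k ≤ 7)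
    (hdom : ∀ (κ : Type) [Fintype κ] (p : κ → unitInterval), (∀ e, (p e : ℝ) ∈ Set.Ioo (0 : ℝ) 1) →
      ∀ U : Fin k → Set (Set κ), (∀ j, IsUpperSet (U j)) → ∀ e : κ, ∃ c₀ c₁ : ℝ, 0 < c₀ ∧ 0 < c₁ ∧
        c₀ * sahiE (bernoulliWeight p) k (fun j => ind (secAt e false (U j))) +
          c₁ * sahiE (bernoulliWeight p) k (fun j => ind (secAt e true (U j))) ≤ sahiE (bernoulliWeight p) k (fun j => ind (U j))) :
    MasterFamilyEqIff k := by
  intro κ _ p hp U hU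
  exact (sahiE_ind_nonneg_and_eq_zero_iff_on_class_of_minorDomination hk p hp (fun V => ∀ j, IsUpperSet (V j)) (fun V hV => hV)
    (fun V hV e b j => isUpperSet_secAt e b (hV j)) (fun V hV e => hdom κ p hp V hV e) U hU).2

/-- **Sufficiency for positivity, every order `≥ 2`, closed cube**: minor domination with constants `≥ 0` everywhere implies
`MasterFamilyNonneg (n+2)` (= Sahi's `C_{n+2}` for product measures; `n = 1`: Kahn's Conjecture 5). [this work] -/
theorem masterFamilyNonneg_of_minorDomination (n : ℕ)
    (hdom : ∀ (κ : Type) [Fintype κ] (p : κ → unitInterval) (U : Fin (n + 2) → Set (Set κ)), (∀ j, IsUpperSet (U j)) →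
      ∀ e : κ, ∃ c₀ c₁ : ℝ, 0 ≤ c₀ ∧ 0 ≤ c₁ ∧
        c₀ * sahiE (bernoulliWeight p) (n + 2) (fun j => ind (secAt e false (U j))) +
          c₁ * sahiE (bernoulliWeight p) (n + 2) (fun j => ind (secAt e true (U j))) ≤
            sahiE (bernoulliWeight p) (n + 2) (fun j => ind (U j))) :
    MasterFamilyNonneg (n + 2) := by
  intro κ _ p U hU
  exact sahiE_ind_nonneg_on_class_of_minorDomination p (fun V => ∀ j, IsUpperSet (V j))
    (fun V hV e b j => isUpperSet_secAt e b (hV j)) (fun V hV e => hdom κ p V hV e) U hU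

/-- **Necessity**: `MasterFamilyEqIff k` implies minor domination at every interior parameter (every order `k`): if `E_k(U) > 0` small
constants do; if `E_k(U) = 0` then `U ∈ Z_k`, its minors are zero flags (`suppZeroFlag_secAt_family`) and have `E_k = 0`. [this work] -/
theorem minorDomination_of_masterFamilyEqIff {k : ℕ} (hEq : MasterFamilyEqIff k) (κ : Type) [Fintype κ] (p : κ → unitInterval)
    (hp : ∀ e, (p e : ℝ) ∈ Set.Ioo (0 : ℝ) 1) (U : Fin k → Set (Set κ)) (hU : ∀ j, IsUpperSet (U j)) (e : κ) :
    ∃ c₀ c₁ : ℝ, 0 < c₀ ∧ 0 < c₁ ∧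
      c₀ * sahiE (bernoulliWeight p) k (fun j => ind (secAt e false (U j))) +
        c₁ * sahiE (bernoulliWeight p) k (fun j => ind (secAt e true (U j))) ≤ sahiE (bernoulliWeight p) k (fun j => ind (U j)) := by
  set E := sahiE (bernoulliWeight p) k (fun j => ind (U j)) with hE
  set A₀ := sahiE (bernoulliWeight p) k (fun j => ind (secAt e false (U j))) with hA₀
  set A₁ := sahiE (bernoulliWeight p) k (fun j => ind (secAt e true (U j))) with hA₁
  have hnn := masterFamilyNonneg_of_masterFamilyEqIff hEq
  have hE0 : 0 ≤ E := hnn κ p U hU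
  have h00 : 0 ≤ A₀ := hnn κ p _ fun j => isUpperSet_secAt e false (hU j)
  have h10 : 0 ≤ A₁ := hnn κ p _ fun j => isUpperSet_secAt e true (hU j)
  rcases hE0.lt_or_eq with hpos | hzero
  · refine ⟨E / (2 * (A₀ + 1)), E / (2 * (A₁ + 1)), by positivity, by positivity, ?_⟩
    have e0 : E / (2 * (A₀ + 1)) * A₀ ≤ E / 2 := by
      rw [div_mul_eq_mul_div, div_le_iff₀ (by positivity)]; nlinarith
    have e1 : E / (2 * (A₁ + 1)) * A₁ ≤ E / 2 := by
      rw [div_mul_eq_mul_div, div_le_iff₀ (by positivity)]; nlinarith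
    linarith
  · have hZ : SuppZeroFlag k U := (hEq κ p hp U hU).1 hzero.symm
    have z0 : A₀ = 0 := masterFamilyEqIff_mpr k κ p _ (suppZeroFlag_secAt_family e false k U hZ)
    have z1 : A₁ = 0 := masterFamilyEqIff_mpr k κ p _ (suppZeroFlag_secAt_family e true k U hZ)
    exact ⟨1, 1, one_pos, one_pos, by rw [z0, z1, ← hzero]; simp⟩

/-- **THE EQUIVALENCE (`k ≤ 7`)**: the pointwise master conjecture `MasterFamilyEqIff k` holds iff every increasing `k`-family on every
finite cube dominates its two one-coordinate minors at every coordinate and every interior parameter: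
`∃ c₀, c₁ > 0, c₀·E_k(μ_p; U^{e←0}) + c₁·E_k(μ_p; U^{e←1}) ≤ E_k(μ_p; U)`. [this work] -/
theorem masterFamilyEqIff_iff_minorDomination {k : ℕ} (hk : k ≤ 7) :
    MasterFamilyEqIff k ↔
      ∀ (κ : Type) [Fintype κ] (p : κ → unitInterval), (∀ e, (p e : ℝ) ∈ Set.Ioo (0 : ℝ) 1) →
        ∀ U : Fin k → Set (Set κ), (∀ j, IsUpperSet (U j)) → ∀ e : κ, ∃ c₀ c₁ : ℝ, 0 < c₀ ∧ 0 < c₁ ∧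
          c₀ * sahiE (bernoulliWeight p) k (fun j => ind (secAt e false (U j))) +
            c₁ * sahiE (bernoulliWeight p) k (fun j => ind (secAt e true (U j))) ≤ sahiE (bernoulliWeight p) k (fun j => ind (U j)) :=
  ⟨fun h κ _ p hp U hU e => minorDomination_of_masterFamilyEqIff h κ p hp U hU e, masterFamilyEqIff_of_minorDomination hk⟩

/-- Order 3 spelled out: **the pointwise equality conjecture at order 3 (⊇ Kahn's Conjecture 5) is equivalent to the domination schema
`∃ c₀, c₁ > 0, c₀·E₃(A_e,B_e,C_e) + c₁·E₃(A^e,B^e,C^e) ≤ E₃(A,B,C)`** over all increasing triples, coordinates and interior product measures.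
[this work] -/
theorem masterFamilyEqIff_three_iff_minorDomination :
    MasterFamilyEqIff 3 ↔
      ∀ (κ : Type) [Fintype κ] (p : κ → unitInterval), (∀ e, (p e : ℝ) ∈ Set.Ioo (0 : ℝ) 1) →
        ∀ U : Fin 3 → Set (Set κ), (∀ j, IsUpperSet (U j)) → ∀ e : κ, ∃ c₀ c₁ : ℝ, 0 < c₀ ∧ 0 < c₁ ∧
          c₀ * sahiE (bernoulliWeight p) 3 (fun j => ind (secAt e false (U j))) +
            c₁ * sahiE (bernoulliWeight p) 3 (fun j => ind (secAt e true (U j))) ≤ sahiE (bernoulliWeight p) 3 (fun j => ind (U j)) :=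
  masterFamilyEqIff_iff_minorDomination (by norm_num)

/-! ### 4. Order 3: domination from the one-edge Bernstein (orthant) condition -/

/-- **Nonnegative mixed Bernstein coefficients along `e` give domination along `e`** with the constants `(1−p_e)³, p_e³` (P3's generic
three-slot cell: `E₃(U) = (1−t)³E₃(U^{e←0}) + t(1−t)²·mixC1_e + t²(1−t)·mixC2_e + t³E₃(U^{e←1})`, `t = p_e`).  Only the weighted sum
`(1−t)·mixC1_e + t·mixC2_e ≥ 0` is used. [this work] -/
theorem minorDomination_of_mixC_nonneg (p : ι → unitInterval) (U : Fin 3 → Set (Set ι)) (hU : ∀ j, IsUpperSet (U j)) (e : ι)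
    (h : 0 ≤ (1 - (p e : ℝ)) * mixC1 (bernoulliWeight p) (fun j => secAt e false (U j)) (fun j => secAt e true (U j)) +
      (p e : ℝ) * mixC2 (bernoulliWeight p) (fun j => secAt e false (U j)) (fun j => secAt e true (U j))) :
    (1 - (p e : ℝ)) ^ 3 * sahiE (bernoulliWeight p) 3 (fun j => ind (secAt e false (U j))) +
      (p e : ℝ) ^ 3 * sahiE (bernoulliWeight p) 3 (fun j => ind (secAt e true (U j))) ≤ sahiE (bernoulliWeight p) 3 (fun j => ind (U j)) := by
  rw [sahiE_three_bernstein_secAt e U hU p]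
  have ht0 : 0 ≤ (p e : ℝ) := (p e).2.1
  have ht1 : 0 ≤ 1 - (p e : ℝ) := sub_nonneg.2 (p e).2.2
  have := mul_nonneg (mul_nonneg ht0 ht1) h
  nlinarith

/-- **`H(1,3)` at an interior parameter on a section-closed class ⟹ the pointwise master statement at order 3 on the class**: if every
triple of `𝒞` has `(1−p_e)·mixC1_e + p_e·mixC2_e ≥ 0` at `p` for every coordinate `e` (in particular if both mixed coefficients are `≥ 0`),
then `E₃(μ_p; 1_U) ≥ 0` and `E₃(μ_p; 1_U) = 0 ↔ U ∈ Z₃` for every `U ∈ 𝒞`. [this work] -/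
theorem sahiE_three_ind_nonneg_and_eq_zero_iff_on_class_of_mixC_nonneg (p : ι → unitInterval)
    (hp : ∀ e, (p e : ℝ) ∈ Set.Ioo (0 : ℝ) 1) (𝒞 : (Fin 3 → Set (Set ι)) → Prop) (h𝒞 : ∀ U, 𝒞 U → ∀ j, IsUpperSet (U j))
    (hsec : ∀ U, 𝒞 U → ∀ (e : ι) (b : Bool), 𝒞 (fun j => secAt e b (U j)))
    (hmix : ∀ U, 𝒞 U → ∀ e : ι,
      0 ≤ (1 - (p e : ℝ)) * mixC1 (bernoulliWeight p) (fun j => secAt e false (U j)) (fun j => secAt e true (U j)) +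
        (p e : ℝ) * mixC2 (bernoulliWeight p) (fun j => secAt e false (U j)) (fun j => secAt e true (U j)))
    (U : Fin 3 → Set (Set ι)) (hU : 𝒞 U) :
    0 ≤ sahiE (bernoulliWeight p) 3 (fun j => ind (U j)) ∧
      (sahiE (bernoulliWeight p) 3 (fun j => ind (U j)) = 0 ↔ SuppZeroFlag 3 U) :=
  sahiE_ind_nonneg_and_eq_zero_iff_on_class_of_minorDomination (by norm_num) p hp 𝒞 h𝒞 hsec
    (fun V hV e => ⟨(1 - (p e : ℝ)) ^ 3, (p e : ℝ) ^ 3, pow_pos (sub_pos.2 (hp e).2) 3, pow_pos (hp e).1 3,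
      minorDomination_of_mixC_nonneg p V (h𝒞 V hV) e (hmix V hV e)⟩) U hU

/-- **`H(1,3)` everywhere ⟹ `MasterFamilyEqIff 3`**: if both mixed one-coordinate Bernstein coefficients of every increasing triple are
`≥ 0` at every coordinate and every interior parameter, the pointwise equality conjecture holds at order 3 (gen 14 derived Kahn's
Conjecture 5 from the same hypothesis; gen 13 needed the top-corner comb certificate (M⁺-3) for the equality statement). [this work] -/
theorem masterFamilyEqIff_three_of_mixC_nonneg
    (h : ∀ (κ : Type) [Fintype κ] (p : κ → unitInterval), (∀ e, (p e : ℝ) ∈ Set.Ioo (0 : ℝ) 1) →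
      ∀ U : Fin 3 → Set (Set κ), (∀ j, IsUpperSet (U j)) → ∀ e : κ,
        0 ≤ mixC1 (bernoulliWeight p) (fun j => secAt e false (U j)) (fun j => secAt e true (U j)) ∧
          0 ≤ mixC2 (bernoulliWeight p) (fun j => secAt e false (U j)) (fun j => secAt e true (U j))) :
    MasterFamilyEqIff 3 := by
  refine masterFamilyEqIff_of_minorDomination (by norm_num) fun κ _ p hp U hU e => ?_
  obtain ⟨h1, h2⟩ := h κ p hp U hU e
  refine ⟨(1 - (p e : ℝ)) ^ 3, (p e : ℝ) ^ 3, pow_pos (sub_pos.2 (hp e).2) 3, pow_pos (hp e).1 3,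
    minorDomination_of_mixC_nonneg p U hU e ?_⟩
  exact add_nonneg (mul_nonneg (sub_nonneg.2 (p e).2.2) h1) (mul_nonneg (p e).2.1 h2)

end Pointwise

end Summit.CriticalPhenomena.PercolationContinuityZ3.Theorems
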